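import Literature.NumberTheory.Transcendental.KZCalculusProofs
import Literature.NumberTheory.Transcendental.KZLogCalculusProofs
import Literature.NumberTheory.Transcendental.KZGroundingRelations
import Literature.NumberTheory.Transcendental.KZCubicalCalculus
import Summits.KontsevichZagierPeriods.KontsevichZagierPeriods.Theorems.UnfoldedStokesStokesGenerationStubGermToOanAuxSeries

/-!
# `StokesGeneration` (stmt-3586), line `fibrewise_stokes`, stub S3 — I: calibration over one cell

First helper file for the lead's stub `stub_fibrewiseStokesCalibration` (S3 of the line
`Cruxes/StokesGeneration/Lines/fibrewise_stokes.lean`): the BAND-BY-BAND Newton–Leibniz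
bookkeeping over one base cell `T ⊆ [0,1]^m`, last coordinate distinguished.

Data: sections `η₀ < η₁ < ⋯ < η_{p+1}` on `T`, `ℚ`-semialgebraic, with `η₀ ≡ 0`, `η_{p+1} ≡ 1`;
functions `G`, `D` that are `ℚ`-semialgebraic on the closed cube `Q = [0,1]^{m+1}`, `D` integrable
on `Q`, `|G| ≤ B` on `Q`; `G` continuous along each closed vertical fibre `{x} × [0,1]`, `x ∈ T`,
and differentiable along it with derivative `D` strictly between consecutive sections. Then
(`of_sub_of_mem_relations_cellBands`)
`[T × [0,1], D] ≡ [T × [0,1], G(·,1) − G(·,0)]` modulo the moves: cut along the closed bands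
`η_k ≤ t ≤ η_{k+1}` (rule (1a); graphs are null), one Newton–Leibniz move per band with primitive
`G` itself (rule (3)), telescoping of the base terms `G(x, η_{k+1} x) − G(x, η_k x)` (rule (1b)), and
re-inflation of `[T, G(·,1) − G(·,0)]` by a slab (rule (3)).
[Kontsevich–Zagier 2001, §1.2, rules (1), (3)]
-/

noncomputable section

set_option linter.dupNamespace false

namespace Summit.KontsevichZagierPeriods.KontsevichZagierPeriods.Cruxes.StokesGeneration.FibrewiseStokes

open MeasureTheory Set Filter Topology
open scoped ENNReal
open Literature.ModelTheory.ExponentialFields (IsSemialgebraic)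
open Literature.NumberTheory.Transcendental
open Literature.NumberTheory.Transcendental.KZ

variable {m : ℕ}

/-! ## Small facts -/

/-- Telescoping over `Fin (n + 1)`: `Σ_k (f (k+1) − f k) = f n − f 0`. [folklore] -/
theorem sum_succ_sub_castSucc {M : Type*} [AddCommGroup M] (n : ℕ) (f : Fin (n + 1) → M) :
    ∑ k : Fin n, (f k.succ - f k.castSucc) = f (Fin.last n) - f 0 := by
  induction n with
  | zero => simp
  | succ n ih =>
    rw [Fin.sum_univ_castSucc]
    have h : ∑ k : Fin n, (f k.castSucc.succ - f k.castSucc.castSucc) = f (Fin.last n).castSucc - f 0 := by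
      have := ih (fun j => f j.castSucc)
      simpa only [Fin.succ_castSucc, Fin.castSucc_zero] using this
    rw [h, Fin.succ_last]
    abel

/-- `Fin.snoc x t` lies in the closed cube iff `x` does and `t ∈ [0,1]`. [folklore] -/
theorem snoc_mem_cubePi_iff (x : Fin m → ℝ) (t : ℝ) :
    (Fin.snoc x t : Fin (m + 1) → ℝ) ∈ Set.pi Set.univ (fun _ : Fin (m + 1) => Set.Icc (0:ℝ) 1) ↔
      x ∈ Set.pi Set.univ (fun _ : Fin m => Set.Icc (0:ℝ) 1) ∧ t ∈ Set.Icc (0:ℝ) 1 := by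
  simp only [Set.mem_univ_pi, Fin.forall_fin_succ', Fin.snoc_castSucc, Fin.snoc_last]

/-- The closed cube of dimension `m + 1` is the band `0 ≤ t ≤ 1` over the closed cube of
dimension `m`. [folklore] -/
theorem cubePi_succ_eq_band (m : ℕ) :
    Set.pi Set.univ (fun _ : Fin (m + 1) => Set.Icc (0:ℝ) 1) =
      KZlog.band (Set.pi Set.univ (fun _ : Fin m => Set.Icc (0:ℝ) 1)) (fun _ => 0) (fun _ => 1) := by
  ext z
  rw [KZlog.mem_band, Set.mem_univ_pi, Set.mem_univ_pi, Fin.forall_fin_succ']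
  exact Iff.rfl

/-- A bounded `ℚ`-semialgebraic function on a `ℚ`-semialgebraic set of finite volume is integrable
there. [folklore] -/
theorem integrableOn_of_abs_le {N : ℕ} {S : Set (Fin N → ℝ)} (hS : IsSemialgebraic ℚ S)
    (hSfin : volume S ≠ ⊤) {f : (Fin N → ℝ) → ℝ} (hf : IsSemialgebraicFunOn ℚ S f) {B : ℝ}
    (hB : ∀ x ∈ S, |f x| ≤ B) : IntegrableOn f S := by
  have hSm : MeasurableSet S := IsSemialgebraic.measurableSet_holds hS
  refine ⟨aestronglyMeasurable_of_isSemialgebraicFunOn hf hSm,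
    HasFiniteIntegral.restrict_of_bounded B hSfin.lt_top
      ((ae_restrict_mem hSm).mono fun x hx => ?_)⟩
  rw [Real.norm_eq_abs]
  exact hB x hx

/-- `x ↦ G (x, u x)` is `ℚ`-semialgebraic on `T` when `G` is `ℚ`-semialgebraic on the cube, `u` is
`ℚ`-semialgebraic on `T ⊆ [0,1]^m` and takes values in `[0,1]`. [cite: BochnakCosteRoy1998, Prop. 2.2.6] -/
theorem isSemialgebraicFunOn_comp_snoc {T : Set (Fin m → ℝ)} (hT : IsSemialgebraic ℚ T)
    (hTQ : T ⊆ Set.pi Set.univ (fun _ : Fin m => Set.Icc (0:ℝ) 1))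
    {G : (Fin (m + 1) → ℝ) → ℝ}
    (hG : IsSemialgebraicFunOn ℚ (Set.pi Set.univ (fun _ : Fin (m + 1) => Set.Icc (0:ℝ) 1)) G)
    {u : (Fin m → ℝ) → ℝ} (hu : IsSemialgebraicFunOn ℚ T u) (hu01 : ∀ x ∈ T, u x ∈ Set.Icc (0:ℝ) 1) :
    IsSemialgebraicFunOn ℚ T (fun x => G (Fin.snoc x (u x))) := by
  have hmap : IsSemialgebraicMapOn ℚ T (fun x => (Fin.snoc x (u x) : Fin (m + 1) → ℝ)) := by
    refine IsSemialgebraicMapOn.of_forall hT fun j => ?_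
    refine Fin.lastCases ?_ (fun i => ?_) j
    · simpa only [Fin.snoc_last] using hu
    · simpa only [Fin.snoc_castSucc] using isSemialgebraicFunOn_apply hT i
  exact IsSemialgebraicFunOn.comp_isSemialgebraicMapOn_holds hG hmap fun x hx =>
    (snoc_mem_cubePi_iff x (u x)).2 ⟨hTQ hx, hu01 x hx⟩

/-! ## Calibration over one cell -/

section Cell

variable {p : ℕ} {T : Set (Fin m → ℝ)} (hT : IsSemialgebraic ℚ T)
  (hTQ : T ⊆ Set.pi Set.univ (fun _ : Fin m => Set.Icc (0:ℝ) 1))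
  (η : Fin (p + 2) → (Fin m → ℝ) → ℝ) (hη : ∀ k, IsSemialgebraicFunOn ℚ T (η k))
  (hmono : ∀ x ∈ T, StrictMono fun k => η k x)
  (hη0 : ∀ x ∈ T, η 0 x = 0) (hη1 : ∀ x ∈ T, η (Fin.last (p + 1)) x = 1)
  {G D : (Fin (m + 1) → ℝ) → ℝ}
  (hG : IsSemialgebraicFunOn ℚ (Set.pi Set.univ (fun _ : Fin (m + 1) => Set.Icc (0:ℝ) 1)) G)
  (hD : IsSemialgebraicFunOn ℚ (Set.pi Set.univ (fun _ : Fin (m + 1) => Set.Icc (0:ℝ) 1)) D)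
  (hDint : IntegrableOn D (Set.pi Set.univ (fun _ : Fin (m + 1) => Set.Icc (0:ℝ) 1)))
  {B : ℝ} (hB : ∀ z ∈ Set.pi Set.univ (fun _ : Fin (m + 1) => Set.Icc (0:ℝ) 1), |G z| ≤ B)
  (hcont : ∀ x ∈ T, ContinuousOn (fun s : ℝ => G (Fin.snoc x s)) (Set.Icc (0:ℝ) 1))
  (hder : ∀ x ∈ T, ∀ k : Fin (p + 1), ∀ t ∈ Set.Ioo (η k.castSucc x) (η k.succ x),
    HasDerivAt (fun s : ℝ => G (Fin.snoc x s)) (D (Fin.snoc x t)) t)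

include hmono hη0 hη1 in
/-- All sections take values in `[0,1]` on `T`. [folklore] -/
theorem section_mem_Icc (x : Fin m → ℝ) (hx : x ∈ T) (k : Fin (p + 2)) : η k x ∈ Set.Icc (0:ℝ) 1 := by
  refine ⟨?_, ?_⟩
  · rw [← hη0 x hx]; exact (hmono x hx).monotone (Fin.zero_le _)
  · rw [← hη1 x hx]; exact (hmono x hx).monotone (Fin.le_last _)

include hT hTQ hη hmono hη0 hη1 hG hD hDint hB hcont hder in
/-- **Calibration over one cell.** With the data above, the representations `[T × [0,1], D]` and
`[T × [0,1], G(·,1) − G(·,0)]` differ by relations (see the module docstring for the chain of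
moves). [cite: KontsevichZagier2001, §1.2 rules (1),(3)] -/
theorem of_sub_of_mem_relations_cellBands (RD Rm : IntegralRep (m + 1))
    (hRDd : RD.domain = KZlog.band T (fun _ => 0) (fun _ => 1))
    (hRDi : ∀ z ∈ RD.domain, RD.integrand z = D z)
    (hRmd : Rm.domain = KZlog.band T (fun _ => 0) (fun _ => 1))
    (hRmi : ∀ z ∈ Rm.domain, Rm.integrand z = G (Fin.snoc (Fin.init z) 1) - G (Fin.snoc (Fin.init z) 0)) :
    of RD - of Rm ∈ relations := by
  classical
  have h01 := section_mem_Icc η hmono hη0 hη1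
  have hTm : MeasurableSet T := IsSemialgebraic.measurableSet_holds hT
  have hTfin : volume T ≠ ⊤ :=
    ((measure_mono hTQ).trans_lt (by
      rw [Summit.KontsevichZagierPeriods.KontsevichZagierPeriods.StokesGenerationLine.volume_unitCube]
      exact ENNReal.one_lt_top)).ne
  -- the bands, inside the cube
  set a : Fin (p + 1) → (Fin m → ℝ) → ℝ := fun k => η k.castSucc with ha
  set b : Fin (p + 1) → (Fin m → ℝ) → ℝ := fun k => η k.succ with hb
  have hab : ∀ k, ∀ x ∈ T, a k x < b k x := fun k x hx =>
    hmono x hx (show k.castSucc < k.succ from Fin.castSucc_lt_succ)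
  have hCBQ : ∀ k, KZlog.band T (a k) (b k) ⊆ Set.pi Set.univ (fun _ : Fin (m + 1) => Set.Icc (0:ℝ) 1) := by
    intro k z hz
    rw [KZlog.mem_band] at hz
    rw [← Fin.snoc_init_self z, snoc_mem_cubePi_iff]
    exact ⟨hTQ hz.1, (h01 _ hz.1 _).1.trans hz.2.1, hz.2.2.trans (h01 _ hz.1 _).2⟩
  have hCBsa : ∀ k, IsSemialgebraic ℚ (KZlog.band T (a k) (b k)) := fun k =>
    KZlog.isSemialgebraic_band (hη _) (hη _)
  -- band representations `[band_k, D]`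
  let BdD : Fin (p + 1) → IntegralRep (m + 1) := fun k =>
    ⟨KZlog.band T (a k) (b k), D, hCBsa k, hD.mono (hCBQ k) (hCBsa k), hDint.mono_set (hCBQ k)⟩
  -- base representations `[T, G(·, η_{k+1}) − G(·, η_k)]`
  have hGsnoc : ∀ j, IsSemialgebraicFunOn ℚ T (fun x => G (Fin.snoc x (η j x))) := fun j =>
    isSemialgebraicFunOn_comp_snoc hT hTQ hG (hη j) fun x hx => h01 x hx j
  have hGsnoc_bd : ∀ j, ∀ x ∈ T, |G (Fin.snoc x (η j x))| ≤ B := fun j x hx =>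
    hB _ ((snoc_mem_cubePi_iff x _).2 ⟨hTQ hx, h01 x hx j⟩)
  have hbase_sa : ∀ k : Fin (p + 1), IsSemialgebraicFunOn ℚ T
      (fun x => G (Fin.snoc x (b k x)) - G (Fin.snoc x (a k x))) := fun k =>
    IsSemialgebraicFunOn.sub_holds (hGsnoc _) (hGsnoc _)
  have hbase_bd : ∀ k : Fin (p + 1), ∀ x ∈ T, |G (Fin.snoc x (b k x)) - G (Fin.snoc x (a k x))| ≤ B + B :=
    fun k x hx => (abs_sub _ _).trans (add_le_add (hGsnoc_bd _ x hx) (hGsnoc_bd _ x hx))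
  let base : Fin (p + 1) → IntegralRep m := fun k =>
    ⟨T, fun x => G (Fin.snoc x (b k x)) - G (Fin.snoc x (a k x)), hT, hbase_sa k,
      integrableOn_of_abs_le hT hTfin (hbase_sa k) (hbase_bd k)⟩
  -- the total base representation `[T, G(·,1) − G(·,0)]`
  have htot_sa : IsSemialgebraicFunOn ℚ T (fun x => G (Fin.snoc x 1) - G (Fin.snoc x 0)) := by
    refine (IsSemialgebraicFunOn.sub_holds (hGsnoc (Fin.last (p + 1))) (hGsnoc 0)).congr fun x hx => ?_
    show G (Fin.snoc x (η (Fin.last (p + 1)) x)) - G (Fin.snoc x (η 0 x)) = G (Fin.snoc x 1) - G (Fin.snoc x 0)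
    rw [hη0 x hx, hη1 x hx]
  have htot_bd : ∀ x ∈ T, |G (Fin.snoc x 1) - G (Fin.snoc x 0)| ≤ B + B := fun x hx => by
    have h1 := hGsnoc_bd (Fin.last (p + 1)) x hx
    have h0 := hGsnoc_bd 0 x hx
    rw [hη1 x hx] at h1
    rw [hη0 x hx] at h0
    exact (abs_sub _ _).trans (add_le_add h1 h0)
  let baseM : IntegralRep m :=
    ⟨T, fun x => G (Fin.snoc x 1) - G (Fin.snoc x 0), hT, htot_sa, integrableOn_of_abs_le hT hTfin htot_sa htot_bd⟩
  -- (1) `[RD] ≡ Σ_k [BdD k]` (rule (1a): the closed bands tile `T × [0,1]`, overlaps are graphs)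
  have e1 : of RD - ∑ k, of (BdD k) ∈ relations := by
    refine of_sub_sum_of_mem_relations Finset.univ RD BdD (fun k _ => ?_) (fun k _ z hz => ?_) ?_ ?_
    · -- bands lie inside the big band
      have : (BdD k).domain \ RD.domain = ∅ := by
        refine Set.eq_empty_iff_forall_notMem.mpr fun z hz => hz.2 ?_
        have hz1 : z ∈ KZlog.band T (a k) (b k) := hz.1
        rw [hRDd, KZlog.mem_band]
        rw [KZlog.mem_band] at hz1
        exact ⟨hz1.1, (h01 _ hz1.1 _).1.trans hz1.2.1, hz1.2.2.trans (h01 _ hz1.1 _).2⟩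
      rw [this, measure_empty]
    · exact (hRDi z hz.2).symm
    · -- the bands cover the big band
      have : RD.domain \ ⋃ k ∈ (Finset.univ : Finset (Fin (p + 1))), (BdD k).domain = ∅ := by
        refine Set.eq_empty_iff_forall_notMem.mpr fun z hz' => hz'.2 ?_
        have hz := hz'.1
        rw [hRDd, KZlog.mem_band] at hz
        obtain ⟨hxT, ht0, ht1⟩ := hz
        set x := Fin.init z
        set t := z (Fin.last m)
        -- the largest section below `t`
        let Sx : Finset (Fin (p + 2)) := Finset.univ.filter fun j => η j x ≤ t
        have hSx : Sx.Nonempty := ⟨0, by simp [Sx, hη0 x hxT, ht0]⟩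
        set j₀ := Sx.max' hSx with hj₀
        have hj₀mem : j₀ ∈ Sx := Finset.max'_mem Sx hSx
        have hj₀le : η j₀ x ≤ t := (Finset.mem_filter.1 hj₀mem).2
        simp only [Finset.mem_univ, iUnion_true, mem_iUnion]
        by_cases hlast : j₀ = Fin.last (p + 1)
        · -- `t = 1`: use the top band
          refine ⟨Fin.last p, ?_⟩
          change z ∈ KZlog.band T (a (Fin.last p)) (b (Fin.last p))
          rw [KZlog.mem_band]
          refine ⟨hxT, ?_, ?_⟩
          · have h1t : 1 ≤ t := by rw [← hη1 x hxT, ← hlast]; exact hj₀le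
            change η (Fin.last p).castSucc x ≤ t
            exact ((h01 x hxT _).2).trans h1t
          · change t ≤ η (Fin.last p).succ x
            rw [Fin.succ_last, hη1 x hxT]; exact ht1
        · refine ⟨j₀.castPred hlast, ?_⟩
          change z ∈ KZlog.band T (a (j₀.castPred hlast)) (b (j₀.castPred hlast))
          rw [KZlog.mem_band]
          refine ⟨hxT, ?_, ?_⟩
          · change η (j₀.castPred hlast).castSucc x ≤ t
            rw [Fin.castSucc_castPred]; exact hj₀le
          · change t ≤ η (j₀.castPred hlast).succ x
            by_contra hlt
            push Not at hlt
            have hmem : (j₀.castPred hlast).succ ∈ Sx := by simp [Sx, hlt.le]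
            have := Finset.le_max' Sx _ hmem
            rw [← hj₀] at this
            have hlt' : j₀ < (j₀.castPred hlast).succ := by
              conv_lhs => rw [← Fin.castSucc_castPred j₀ hlast]
              exact Fin.castSucc_lt_succ
            exact absurd this (not_le.2 hlt')
      rw [this, measure_empty]
    · -- two distinct closed bands meet in a graph (null)
      have key : ∀ k k' : Fin (p + 1), k < k' →
          volume ((BdD k).domain ∩ (BdD k').domain) = 0 := by
        intro k k' hlt
        refine measure_mono_null (fun z hz => ?_) (volume_graph_eq_zero (hη k.succ))
        obtain ⟨hz1, hz2⟩ := hz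
        have hz1' : z ∈ KZlog.band T (a k) (b k) := hz1
        have hz2' : z ∈ KZlog.band T (a k') (b k') := hz2
        rw [KZlog.mem_band] at hz1' hz2'
        refine ⟨hz1'.1, le_antisymm hz1'.2.2 ?_⟩
        have hkk' : k.succ ≤ k'.castSucc := by
          rw [Fin.le_def, Fin.val_succ, Fin.val_castSucc]; exact hlt
        exact ((hmono _ hz1'.1).monotone hkk').trans hz2'.2.1
      intro k _ k' _ hne
      rcases lt_or_gt_of_ne hne with h | h
      · exact key k k' h
      · rw [Set.inter_comm]; exact key k' k h
  -- (2) one Newton–Leibniz move per band, primitive `G`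
  have e2 : ∀ k, of (BdD k) - of (base k) ∈ relations := by
    intro k
    refine newtonLeibnizRel_subset_relations ⟨m, BdD k, base k, a k, b k, G,
      hG.mono (hCBQ k) (hCBsa k), hη _, hη _, fun x hx => (hab k x hx).le, rfl,
      fun x hx => ?_, fun x hx t ht => ?_, fun x _ => rfl, rfl⟩
    · exact (hcont x hx).mono (Icc_subset_Icc (h01 x hx _).1 (h01 x hx _).2)
    · exact hder x hx k t ht
  -- (3) telescoping of the base terms (rule (1b))
  have e3 : of baseM - ∑ k, of (base k) ∈ relations := by
    refine of_sub_sum_integrand_mem_relations Finset.univ base baseM (fun k _ => rfl) fun x hx => ?_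
    change G (Fin.snoc x 1) - G (Fin.snoc x 0) =
      ∑ k : Fin (p + 1), (G (Fin.snoc x (η k.succ x)) - G (Fin.snoc x (η k.castSucc x)))
    rw [sum_succ_sub_castSucc (p + 1) (fun j => G (Fin.snoc x (η j x))), hη0 x hx, hη1 x hx]
  -- (4) re-inflation of the total base term by a slab (rule (3))
  have e4 : of (baseM.slab 0) - of baseM ∈ relations :=
    newtonLeibnizRel_subset_relations (baseM.of_slab_sub_of_mem_newtonLeibnizRel 0)
  have e5 : of Rm - of (baseM.slab 0) ∈ relations := by
    refine of_sub_of_mem_relations_of_eqOn ?_ fun z hz => ?_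
    · rw [IntegralRep.domain_slab, hRmd]
      ext z
      simp only [IntegralRep.slabDomain, KZlog.mem_band, Nat.cast_zero, zero_add, mem_setOf_eq]
      rfl
    · rw [hRmi z hz]
      rfl
  -- assemble
  have e : of RD - of Rm = (of RD - ∑ k, of (BdD k)) + ∑ k, (of (BdD k) - of (base k)) -
      (of baseM - ∑ k, of (base k)) - (of (baseM.slab 0) - of baseM) - (of Rm - of (baseM.slab 0)) := by
    simp only [Finset.sum_sub_distrib]; abel
  rw [e]
  exact relations.sub_mem (relations.sub_mem (relations.sub_mem (relations.add_mem e1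
    (AddSubgroup.sum_mem _ fun k _ => e2 k)) e3) e4) e5

end Cell

/-- **Calibration over one cell, registered form** (bookkeeping stub `fibCal_cellBands` of crux
stmt-KontsevichZagierPeriods-3586, line `fibrewise_stokes`): all data explicit, see
`of_sub_of_mem_relations_cellBands`. [cite: KontsevichZagier2001, §1.2 rules (1),(3)] -/
theorem fibCal_cellBands : ∀ (m p : ℕ) (T : Set (Fin m → ℝ)) (η : Fin (p + 2) → (Fin m → ℝ) → ℝ) (G D : (Fin (m + 1) → ℝ) → ℝ) (B : ℝ) (RD Rm : IntegralRep (m + 1)), IsSemialgebraic ℚ T → T ⊆ Set.pi Set.univ (fun _ : Fin m => Set.Icc (0:ℝ) 1) → (∀ k, IsSemialgebraicFunOn ℚ T (η k)) → (∀ x ∈ T, StrictMono fun k => η k x) → (∀ x ∈ T, η 0 x = 0) → (∀ x ∈ T, η (Fin.last (p + 1)) x = 1) → IsSemialgebraicFunOn ℚ (Set.pi Set.univ (fun _ : Fin (m + 1) => Set.Icc (0:ℝ) 1)) G → IsSemialgebraicFunOn ℚ (Set.pi Set.univ (fun _ : Fin (m + 1) => Set.Icc (0:ℝ) 1)) D →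 IntegrableOn D (Set.pi Set.univ (fun _ : Fin (m + 1) => Set.Icc (0:ℝ) 1)) → (∀ z ∈ Set.pi Set.univ (fun _ : Fin (m + 1) => Set.Icc (0:ℝ) 1), |G z| ≤ B) → (∀ x ∈ T, ContinuousOn (fun s : ℝ => G (Fin.snoc x s)) (Set.Icc (0:ℝ) 1)) → (∀ x ∈ T, ∀ k : Fin (p + 1), ∀ t ∈ Set.Ioo (η k.castSucc x) (η k.succ x), HasDerivAt (fun s : ℝ => G (Fin.snoc x s)) (D (Fin.snoc x t)) t) → RD.domain = KZlog.band T (fun _ => 0) (fun _ => 1) → (∀ z ∈ RD.domain, RD.integrand z = D z) → Rm.domain = KZlog.band T (fun _ => 0) (fun _ => 1) → (∀ z ∈ Rm.domain, Rm.integrand z = G (Fin.snoc (Fin.init z) 1) - G (Fin.snoc (Fin.init z) 0)) → of RD - of Rm ∈ relations :=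
  fun _ _ _ η _ _ _ RD Rm hT hTQ hη hmono hη0 hη1 hG hD hDint hB hcont hder =>
    of_sub_of_mem_relations_cellBands hT hTQ η hη hmono hη0 hη1 hG hD hDint hB hcont hder RD Rm

end Summit.KontsevichZagierPeriods.KontsevichZagierPeriods.Cruxes.StokesGeneration.FibrewiseStokes
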